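import Mathlib
import HarnessLib
import HarnessLib.Audit
import Summits.QuantumFields.Statement

/-!
Route: BanksZaksTestbed

DORMANT since 2026-09-03T12:30:34Z (reconciler: no traction for 5 d (last activity statement-checked at 2026-08-29T11:38:43Z); parked, not closed — `ledger route dormant route-QuantumFields-BanksZaksTestbed --off` to reactivate) — unstaffed, not closed; items shared with open routes are served there. `ledger route dormant <id> --off` reactivates.

# Route BanksZaksTestbed — sixteen flavours as the laboratory — build the fermionic ultraviolet of
lattice QCD where α never exceeds α* = 2π/151, state it uniformly over the window N_f ≤ 16, import
the infrared

It suffices to show X = P ∧ I (rev 2, route-repair 2026-08-16 after the statement re-type p117723,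
`QCDOf N_f := ∃ reg, HasMassScaling ∧ IsChiralAtZero ∧ ∀ m > 0, body`; rev 1 read X = W ∧ I₁ with I₁
:= W|_{N_f ≤ 3} → QCD), with the card's milestone BZ (card
QuantumFields/QCD/banks-zaks-sixteen-testbed, K1 ∧ K2) and the window statement W (its K3) standing
beside the chain:
P (PinnedFiniteVolumeLimit, new in rev 2): for N_f = 2 and N_f = 3 there is ONE mass-independent
regularisation `reg` (a_k → 0, β_k with N_f-flavour two-loop asymptotic scaling, flavour-blind
m_crit(k) > −1 eventually, Z_m(k) ≍ c (log a_k⁻²)^(γ₀/2β₀)) which is CHIRAL AT ZERO —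
`reg.IsChiralAtZero`: for every ε > 0 some positive mass tuple has no volume-uniform lattice gap ε,
i.e. the reference m_crit(k) sits at (not above) the chiral critical line and the positive
parameters reach arbitrarily light quarks — such that for every positive mass tuple the smeared
renormalised n-point functions of `glue` and of the pseudoscalar bilinears converge on the torus of
EVERY fixed physical side ℓ ≥ ℓ₀ for every tuple of real test functions supported in the ball of
radius ℓ/4 with pairwise-disjoint closed supports, non-degenerately (N1 connected glue 2-point and
N2 every flavour-changing pseudoscalar 2-point ≠ 0 on in-ball time-separated witnesses, N3 connected
glue 3-point ≠ 0 on in-ball pairwise-disjoint witnesses) — W's guarded body at the physical flavour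
numbers plus the pin.
I (InfraredCompletionP, rev 2 of InfraredCompletionR): the infrared half, conceded and imported —
for N_f ∈ {2,3} and EVERY regularisation with those four properties and those finite-volume limits,
`QCDOf N_f` (locate the chiral point m* ≥ 0 of `reg`, re-reference there, thermodynamic limit, OS
axioms, one gap Δ > 0 of the full Hamiltonian at every positive mass, pseudo-Goldstone gaplessness
as m → 0⁺).
W (WindowFiniteVolumeLimitR, rev 1, unchanged): the same guarded finite-volume continuum limit for
EVERY flavour number 2 ≤ N_f ≤ 16 with a FREE reference (no pin) — the window-uniform ultraviolet
deliverable, closable by ultraviolet means alone; its restriction to N_f ≤ 3 is P minus the pin.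
BZ (BanksZaksContinuum, the laboratory): SU(3) lattice gauge theory with SIXTEEN degenerate Wilson
flavours has an asymptotically free continuum limit (`IsQCDAlong`, b₀(16) > 0 > b₁(16)) that is
non-Gaussian, has dynamical quarks, and has NO mass gap — the Banks–Zaks theory, weakly coupled at
every scale (α ≤ α* = 2π/151), the one member of Jaffe–Witten's §5 family "other asymptotically free
gauge theories" that needs no infrared idea; the fermionic multiscale lemmas are proved there first
and are uniform in N_f ≤ 16, which is what W records and P uses at N_f = 2, 3.
WHY THE PIN SITS IN P (the ∃-interface, rev 2): `QCDOf` now pins the additive offset of m_crit to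
the chiral point; a finite-volume existence statement with a free reference may be witnessed with
the reference ABOVE the chiral line (heavy quarks only — admissible before the re-type by the offset
symmetry `qcdOf_iff_threshold`), and no universally quantified infrared item can repair a badly
placed existential witness (the needed shift is downward, into parameters the witness never
visited). The certificate of placement cannot be ultraviolet — the offset a_k M₀/Z_m(k) is below
every power of g₀², the O(a_kΛ) ambiguity of the additive mass — so it is the statement's own
lattice clause `IsChiralAtZero`, the weakest form of "the gap is not bounded below on the positive
side", which forces the chiral point to a parameter m* ≥ 0 and lets I re-reference using only data
at positive parameters. Rejected alternatives (NOTES): W for all-sign masses (θ = π sectors of the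
signed Wilson functional, finite-volume Z may vanish), the pin inside W for all N_f ≤ 16 (an
infrared clause in the vetted ultraviolet milestone), documentation only (the hole stays).
Lean: `PinnedFiniteVolumeLimit ∧ InfraredCompletionP` — P = `∀ Nf : ℕ, 2 ≤ Nf → Nf ≤ 3 → ∃ reg :
QCDRegularisation Nf, (reg.HasMassScaling ∧ (∃ Λ > 0, Tendsto (fun k => reg.β k - afBeta Nf Λ (reg.a
k)) atTop (nhds 0)) ∧ (∀ᶠ k in atTop, (-1 : ℝ) < reg.mcrit k) ∧ reg.IsChiralAtZero) ∧ (∀ m : Fin Nf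
→ ℝ, (∀ fl, 0 < m fl) → <the guarded finite-volume body of WindowFiniteVolumeLimitR, verbatim>)`; I
= `∀ Nf : ℕ, 2 ≤ Nf → Nf ≤ 3 → ∀ reg : QCDRegularisation Nf, <those four reg-conjuncts> → <that
body> → QCDOf Nf` (full terms in the decls below).

## Assembly
Pure logic, term-checked sorry-free in the planner's Sketch.lean (rc 0; axioms propext /
Classical.choice / Quot.sound) as the D-0027 deciding theorem `closes : PinnedFiniteVolumeLimit →
InfraredCompletionP → QCD`: `QCD = QCDOf 2 ∧ QCDOf 3`; for N_f = 2 and N_f = 3 destructure P's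
witness `⟨reg, hreg, hbody⟩` and apply I at `reg`. WindowFiniteVolumeLimitR (W|_{≤3} is P minus the
pin), BanksZaksContinuum (laboratory and kill switch) and BanksZaksArithmetic (its numbers) are
deliberately outside the chain. Rev 1's `closes hW hIR := hIR (restriction N_f ≤ 3 → N_f ≤ 16)`
still elaborated after the re-type (I₁ concluded `QCD` by name) but no longer matched the items'
division of labour; it is superseded.

Rationale: WHY THIS LINE. Toy-model ladder run from the TOP of the asymptotic-freedom window (BanksZaks1982,
Caswell1974): with the tree's coefficients
b₀(16) = (1/3)/(16π²) > 0 and b₁(16) = −(302/3)/(16π²)² < 0 the two-loop flow of sixteen-flavour QCD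
has an infrared zero at
g*² = 16π²/302, α* = 2π/151 ≈ 0.042, so the whole renormalisation-group trajectory from the cutoff
to the deep infrared stays at
couplings where Bałaban-type small-field expansions are designed to converge (Balaban1987RG1,
Balaban1989LargeFieldII,
BalabanOcarrollSchor1989 for block fermions in external gauge fields, Dimock2022QED3 for dynamical
abelian fermions,
MagnenRivasseauSeneor1993 for rigorous two-loop asymptotic freedom) and the construction of a weakly
non-Gaussian fixed point by
convergent RG has templates (GawedzkiKupiainenMasslessLattice1985, BrydgesMitterScoppola2003,
GiulianiMastropietroRychkov2021,
BauerschmidtBrydgesSlade2019RG). Imported from statistical mechanics / constructive RG: fixed-point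
constructions in Banach spaces
of quasi-local activities and marginal-flow bookkeeping over infinitely many scales; imported from
perturbative QCD: the
Banks–Zaks expansion and the N_f-independence of the ultraviolet counterterm structure
(MontvayMunster1994 §5.1). What the line
does that the other QCD routes do not: HeavyThresholdYMBridge and FemtoStepScaling both CONSUME a
fermionic ultraviolet crux
(there `FermionicUVFlow`, informal; here typed as FemtoStepScaling's `FiniteVolumeContinuumLimit`)
without a setting in which to
prove it; this route supplies the setting — flavour content deletes the strong-coupling regime while
keeping asymptotic freedom
and non-Gaussianity — and states the deliverable uniformly in N_f ≤ 16, of which N_f = 2, 3 is the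
instance the assembly uses.
The negatives index of the summit is empty (2026-08-15). REV 1 (route-repair 2026-08-15, refuter
crux-attacks rattack-9563/ -9564 +
route-review rreview-0815T14-0-g2, class refuted-misstated): W and I are restated as
WindowFiniteVolumeLimitR / InfraredCompletionR —
the convergence clause is GUARDED (test tuples supported in the ball of radius ℓ/4 with
pairwise-disjoint closed supports: rev 0
quantified over all Schwartz tuples, and cutoff power counting at coincident supports made W false
and I vacuous; the in-ball guard
also removes torus-seam contact, which FemtoStepScaling's disjointness-only repair stmt-11450 still
admits — flagged to that route),
N1/N2 witnesses in-ball time-separated, N3 in-ball pairwise-disjoint; Assembly and `closes`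
re-proved by the same restriction. REV 2 (route-repair 2026-08-16, statement re-type p117723:
`QCDOf` gained `reg.IsChiralAtZero`, pinning the additive offset of m_crit to the chiral point):
`closes` still elaborated (I₁ concluded `QCD` by name) but the ∃-interface broke — a W-witness with
a free reference may sit above the chiral line and then supplies heavy-quark data only (admissible
before by `qcdOf_iff_threshold`), so I₁ would have had to regenerate the ultraviolet for light
quarks. Repair: the chain's existence half becomes P = PinnedFiniteVolumeLimit (W's guarded body at
N_f = 2, 3 for a regularisation that is moreover `IsChiralAtZero`, the weakest lattice certificate
that the reference is not above the chiral line — no ultraviolet certificate exists, the offset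
being below every power of g₀²), the infrared half becomes InfraredCompletionP (universal over such
pinned regularisations, concluding `QCDOf N_f`), `closes hP hI : QCD` is again pure logic, and W
stays verbatim (vetted, window-uniform, closable by ultraviolet means alone) beside BZ outside the
chain. The new conjunct is thus SUPPLIED AS A HYPOTHESIS (the pin in P: imported light-quark
gaplessness, GellmannOakesRenner1968, VafaWitten1984CMP, tHooft1980Naturalness) and DELIVERED for
the final regularisation by I (re-referencing at m* ≥ 0, pseudo-Goldstone gaplessness from above).

RANKED CRUXES. #2 BanksZaksContinuum (crux) — there is a sequential lattice-QCD scheme with SIXTEEN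
flavour-degenerate Wilson quarks (all bare masses equal at every step; a_k → 0, a_k L_k → ∞, β_k
with N_f = 16 two-loop asymptotic scaling) and OS data T for the species of `QCDField 16` with
`IsQCDAlong sch T`, `T.IsNontrivial glue`, `T.IsNonGaussian glue`, every flavour-changing `pseudoRe
f g` non-trivial, and NO mass gap: `¬ T.HasMassGap Δ` for every Δ > 0 (card K1 ∧ K2 ⇒ `BanksZaksOf
16`; gaplessness is the typed certificate that the limit is the massless infrared-conformal theory,
flavour degeneracy excludes a partially-massive witness whose light sector breaks chiral symmetry).
The testbed rung: deliberately outside the Assembly; its layer-2 children (bounded-coupling block RG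
with g_j ≤ 1.2 g* at all scales; convergence to the non-Gaussian fixed point) are where the
fermionic lemmas of WindowFiniteVolumeLimit are first proved. [difficulty: open-problem] (why it
might fail: No rigorous IR fixed point with a dynamical gauge field exists in any d; g*² = 0.52 (β_W
≈ 11.5) must lie inside the NON-explicit convergence window γ of Bałaban's small-field expansions at
every scale; θ = 2b₀g*² ≈ 2·10⁻³: marginal flow at both ends, errors summed over infinitely many
scales.) [BanksZaks1982, Caswell1974, GiulianiMastropietroRychkov2021,
GawedzkiKupiainenMasslessLattice1985, BauerschmidtBrydgesSlade2019RG, Balaban1989LargeFieldII,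
BalabanOcarrollSchor1989, Dimock2022QED3, DamgaardEtAl1997, Hasenfratz2009, RyttovShrock2011]
#3 WindowFiniteVolumeLimitR (crux; rev 1 of WindowFiniteVolumeLimit stmt-9563) — for every N_f with
2 ≤ N_f ≤ 16 there is a mass-independent regularisation `reg` (leading-log mass scaling, N_f-flavour
two-loop asymptotic scaling, m_crit(k) > −1 eventually) such that for EVERY positive mass tuple m
there are species renormalisations z, shift, a limit functional W and ℓ₀ > 0 with: for every
physical side ℓ ≥ ℓ₀, every species string and every tuple of real test functions with `tsupport (f
i) ⊆ Metric.ball 0 (ℓ/4)` and pairwise-disjoint tsupports, the smeared renormalised n-point function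
under `qcdTorusExpect` on the torus of side 2⌊ℓ/2a_k⌋+1 converges to W ℓ n σ f, non-degenerately (N1
glue 2-point and N2 every flavour-changing pseudoRe 2-point on in-ball time-separated witnesses, N3
glue connected 3-point on in-ball pairwise-disjoint witnesses, ≠ 0 at some ℓ ≥ ℓ₀) —
FemtoStepScaling's `FiniteVolumeContinuumLimitR` (stmt-11450) plus the in-ball guard, with `N_f ≤ 3`
replaced by `N_f ≤ 16` (card K3 UniformTransfer). [deps: BanksZaksContinuum] [difficulty:
open-problem] (why it might fail: Block-fermion RG with a DYNAMICAL non-abelian gauge field in d = 4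
was never set up (BOS: external field; Dimock: abelian d = 3); ONE reg and ℓ-independent z, shift
for all ℓ ≥ ℓ₀, m; N2 needs m_crit within O(a_k) of critical; signed weight (odd N_f, split masses);
κ₃ ≠ 0 at separated points.) [Balaban1987RG1, Balaban1989LargeFieldII, BalabanOcarrollSchor1989,
MagnenRivasseauSeneor1993, Dimock2022QED3, MontvayMunster1994, GawedzkiKupiainenMasslessLattice1985,
JaffeWittenClay2006, MohlerSchaefer2020,
Literature.Barriers.QuantumFields.WilsonDeterminantMassSplitting, OsterwalderSeiler1978]
#4 InfraredCompletionP (crux; rev 2 of InfraredCompletionR stmt-13788 ← stmt-9564) — the infrared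
half, imported, now PINNED and universal over the regularisation: for N_f ∈ {2,3} and EVERY
mass-independent `reg` with leading-log mass scaling, N_f-flavour two-loop asymptotic scaling,
m_crit(k) > −1 eventually and `reg.IsChiralAtZero`, IF P's (= W's) guarded non-degenerate
finite-volume continuum limits hold along `reg` for every positive mass tuple, THEN `QCDOf N_f`
(locate the chiral point m* ≥ 0 of reg — the pin excludes a reference above the chiral line, so data
at parameters > m* cover every positive renormalised mass; re-reference m_crit ↦ m_crit + a_k m*/Z_m
inside the ∃ reg of `QCDOf`; thermodynamic limit along the scheme's growing tori, OS axioms E0–E4,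
non-triviality / non-Gaussianity / dynamical quarks from N1–N3, ONE Δ > 0 with `T.HasMassGap Δ` ∧
`HasLatticeMassGap Δ` at every positive mass, and `IsChiralAtZero` of the re-referenced reg =
pseudo-Goldstone gaplessness m_π → 0⁺). Not this route's mechanism: FemtoStepScaling's infrared
package once re-typed for the pin and in-ball-guarded, or any chiral-pinned infrared route
(EulerDescent, ChiralSpinWaves). [deps: PinnedFiniteVolumeLimit] [difficulty: open-problem] (why it
might fail: Carries the whole YM-hard infrared for massive N_f = 2,3 (thermodynamic limit from
in-ball torus data, OS axioms, ONE volume-uniform gap for ALL lattice observables) AND now the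
chiral limit: locating m*, a gap at EVERY positive true mass however small, and m_π → 0⁺ uniformly
in volume.) [JaffeWitten2000, JaffeWittenClay2006, OsterwalderSeiler1978, Seiler1982, Luscher1977,
MontvayMunster1994, SharpeSingleton1998, GellmannOakesRenner1968, GasserLeutwyler1984,
VafaWitten1984CMP]
#5 PinnedFiniteVolumeLimit (crux; new in rev 2) — the chain's existence half, pinned: for N_f = 2
and N_f = 3 there is ONE mass-independent `reg` (leading-log mass scaling, N_f-flavour two-loop
asymptotic scaling, m_crit(k) > −1 eventually) which is CHIRAL AT ZERO — `reg.IsChiralAtZero`: for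
every ε > 0 some positive mass tuple has no volume-uniform lattice gap ε, i.e. the reference sits
at, not above, the chiral critical line — such that for EVERY positive mass tuple
WindowFiniteVolumeLimitR's guarded body holds verbatim (CONV for in-ball pairwise-disjoint Schwartz
tuples on the torus of side 2⌊ℓ/2a_k⌋+1, every ℓ ≥ ℓ₀; N1/N2 in-ball time-separated, N3 in-ball
pairwise-disjoint). Ranked below W because its ultraviolet content IS W|_{≤3}; it adds the one
infrared lattice clause certifying the placement of the reference, which the statement's ∃ reg
forces into the existence item (a free-reference witness cannot be repaired downstream). Expected
proof: W's construction with the RG-chiral reference (running mass 0 at the hand-over scale μ₀ = the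
chiral point up to o(a_k/Z_m(k))) plus one infrared lemma: at small degenerate positive mass the
flavoured pseudoscalar channel has a state lighter than ε uniformly in the volume (the NEGATION of a
uniform gap; no condensate, no Dirac spectral gap needed). [deps: WindowFiniteVolumeLimitR]
[difficulty: open-problem] (why it might fail: All of W's risks at N_f = 2,3 plus the pin: a
volume-uniform UPPER bound on the lightest flavoured state at small m > 0 along the SAME reg (m_π →
0, Goldstone) is proved for no 4d lattice gauge theory at weak coupling; and the RG-tuned reference
must equal the chiral line to o(a_k/Z_m(k)).) [GellmannOakesRenner1968, GasserLeutwyler1984,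
SharpeSingleton1998, VafaWitten1984CMP, tHooft1980Naturalness, MontvayMunster1994,
Balaban1989LargeFieldII, BalabanOcarrollSchor1989, MohlerSchaefer2020, JaffeWitten2000,
Literature.Barriers.QuantumFields.AokiPhaseDichotomy]
#9 BanksZaksArithmetic (support) — the Banks–Zaks arithmetic of the tree's own coefficients
(provable now, `norm_num`/`field_simp` over `betaCoeff₀`, `betaCoeff₁`, `gammaCoeff₀`,
`massExponent`): b₀(16) > 0, b₁(16) < 0, −b₀(16)/b₁(16) = 16π²/302 (so g*² = 16π²/302, α* = g*²/4π =
2π/151), −b₀(15)/b₁(15) = 16π²/88 (second rung, α* = π/22), massExponent 16 = 12 (so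
`HasMassScaling` at N_f = 16 reads Z_m ≍ c (log a_k⁻²)¹²), 0 < b₁(N_f) ↔ N_f ≤ 8 (no two-loop zero
at or below eight flavours), 0 < b₀(N_f) ↔ N_f ≤ 16 (the asymptotic-freedom window). [difficulty:
provable-now] [MontvayMunster1994, BanksZaks1982, Caswell1974]

TWO-LAYER PLAN. Foreseen glued splits (k ≤ 3, depth 1; nothing filed now, both need the two
definition requests below):
BanksZaksContinuum ⇐ BoundedCouplingFlow16 (Bałaban-type gauge-covariant block RG for SU(3) + 16
degenerate Wilson flavours along
β_k → ∞: fermions integrated scale by scale with Gram–Hadamard bounds surviving the large-field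
regions, the one relevant direction
m_crit(k) tuned by a stable-manifold argument, the marginal flow controlled to second order with
remainder O(g_j⁷) so that
g_j ≤ 1.2 g* for all j, k) → InfraredFixedPoint16 (convergence of the RG map to a non-Gaussian fixed
point in a Banach space of
quasi-local gauge-invariant activities: infinite volume, convergence of all gauge-invariant
Schwinger functions, OS axioms,
non-Gaussianity, power-law decay hence no gap) → BanksZaksContinuum.
WindowFiniteVolumeLimitR ⇐ UVToMu0 (the scale-wise lemmas of BoundedCouplingFlow16, uniform in N_f ≤
16 and in the masses, from
a_k down to the scale μ₀ with g(μ₀) = 1.2 g*(16), in a box of any physical side) →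
FiniteBoxCompactness (below μ₀ the box holds
finitely many block variables: a-uniform bounds and a diagonal subsequence for countable dense
families) → MassEquicontinuity
(equicontinuity of the renormalised correlators in m, ℓ and the test functions, so ONE reg serves
all; cf. card
arzela-ascoli-in-the-quark-mass and HeavyThresholdYMBridge's informal support of the same name) →
WindowFiniteVolumeLimitR.
PinnedFiniteVolumeLimit ⇐ W-at-N_f≤3 with the RG-chiral reference (same three children) →
ChiralReach (the infrared lattice lemma: light flavoured pseudoscalar state at small degenerate
positive mass, uniformly in the volume) → P — not filed until W's children exist.
InfraredCompletionP ⇐ ChiralPointLocation (m* := inf of the degenerate parameters above which the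
lattice gap is locally bounded below; pin ⇒ m* ≥ 0; re-referencing lemma reg'.scheme m = reg.scheme
(m + m*)) → FemtoStepScaling's BoxMixingDecayR → PhysicalFiniteSizeCriterionR →
InfiniteVolumePackageR re-typed for the pin (or EulerDescent's RetypedContinuumComplement) →
GoldstoneFromAbove (reg'.IsChiralAtZero), by those routes' `closes` minus their ultraviolet
hypothesis once they adopt the in-ball guard and the pinned hand-over (P's CONV implies stmt-11450's
disjoint-only CONV; our N1–N3 imply theirs).

KILL CRITERIA. ¬BanksZaksContinuum (e.g. a theorem that every `IsQCDAlong` limit with sixteen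
degenerate Wilson flavours is Gaussian, or gapped,
or that no asymptotically scaling critical surface exists at N_f = 16 — a bulk obstruction between β
= ∞ and the massless line,
cf. DamgaardEtAl1997) kills the laboratory: close `refuted:BanksZaksContinuum` unless W has
meanwhile been reached by other means
(then supersede by FemtoStepScaling). ¬WindowFiniteVolumeLimitR witnessed at some N_f ∈ [4, 16]
only: restate W to N_f ∈ {2,3}
(= the guarded FiniteVolumeContinuumLimit) and close `superseded` by FemtoStepScaling — the
uniformity claim was the route. ¬W at N_f ∈ {2,3}
refutes the existence half of QCD as rendered (all UV routes die). ¬PinnedFiniteVolumeLimit by its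
PIN alone (along every asymptotically scaling Wilson regularisation with W's finite-volume limits
the lattice gap stays bounded below over all positive parameters) refutes `QCDOf 2 ∧ QCDOf 3` as
re-typed, not this line: `verdict: misstated` on the conjunct to the operator; ¬P through its W-part
refutes the existence half of QCD as rendered (all UV routes die). ¬InfraredCompletionP = a pinned
regularisation has the guarded finite-volume limits but `QCDOf N_f` fails: the statement is false in
its infrared half; every QCD route closes. A `misstated` verdict on the pin's side (witnesses
approaching the chiral point only from negative mass) is repaired in place, not a kill.
FiniteVolumeContinuumLimit proved elsewhere first moots W's
role in the assembly (BZ keeps its stand-alone value; the route would then close `superseded`). A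
further `misstated` verdict on the
guard (test-function class) is repaired in place again, not a kill.

NOT DECOMPOSED YET. The block-RG vocabulary for Wilson fermions coupled to a dynamical gauge field,
the Banach norm of quasi-local gauge-invariant
activities, the second-order marginal-flow lemma (two-loop coefficient with the right sign out of
the non-perturbative flow,
Wilson-term O(a) artefacts at relative order g²), the stable-manifold tuning of m_crit(k), the
composite-field (E0′) insertion
bounds, the equicontinuity-in-mass lemma, and every constant (γ, g_max = 1.2 g*, μ₀, ℓ₀): all
layer-2 children or prover-attached
lemmas after the definition requests land. The infrared (gap, thermodynamic limit, location of the
chiral point, pseudo-Goldstone gaplessness) is not decomposed here at all — it is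
InfraredCompletionP, imported whole; the pin's infrared lemma inside P (ChiralReach) and the
re-referencing lemma are named in the TWO-LAYER PLAN and not filed.

CHEAPEST FALSIFIER. (i) Arithmetic — done: b₀(16) = (1/3)/(16π²) > 0, b₁(16) = −(302/3)/(16π²)² < 0,
g*² = 16π²/302 = 0.523, α* = 2π/151 = 0.0416,
θ = 2b₀g*² = 2.2·10⁻³ (BanksZaksArithmetic is the Lean form; Sketch.lean elaborates). (ii)
Literature, minutes: does the N_f = 16
zero survive beyond two loops in every scheme? Yes — RyttovShrock2011 (three/four-loop MS-bar: α*
stays ≈ 0.04 at N_f = 16; scheme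
spread grows only towards N_f = 12). (iii) Lattice sanity: DamgaardEtAl1997 / IwasakiEtAl2004 map a
BULK first-order transition for
N_f = 16 Wilson fermions at strong bare coupling with the weak-coupling phase connected to β = ∞ —
consistent (the scheme lives at
β_W ≳ 11); a refuter should check no obstruction is reported on the massless line at weak coupling.
(iv) The real cheap test, on
paper: ONE block integration of 16 Wilson flavours in Bałaban's axial-gauge small-field background
with gauge-covariant Gram
bounds at g = g* — if the fermionic effective action's non-local tails are not summable uniformly in
the block gauge field
already there, BoundedCouplingFlow16 and with it the laboratory premise die (and so does every
fermionic UV programme in the pool). (v) The pin, minutes: junk cannot fake it (a vanishing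
functional SATISFIES `HasLatticeMassGap ε`; probes qcd_p1_p2_p4, rattack-13787) and it reads data
disjoint from W's body, so only physics decides — look for a printed volume-uniform LOWER bound on
m_π at small quark mass for Wilson fermions at weak coupling (none known; Sharpe–Singleton's m_π ≳ a
is fixed-a and dies as a_k → 0).

NUMBERS. b₀(N_f) = (11 − 2N_f/3)/(16π²), b₁(N_f) = (102 − 38N_f/3)/(16π²)² (MontvayMunster1994
(5.66)); N_f = 16: b₀ = 2.11·10⁻³,
b₁ = −4.04·10⁻³, g*² = −b₀/b₁ = 16π²/302 = 0.523, α* = 2π/151 = 0.0416, tree β* = 2/g*² = 3.82 (β_W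
= 11.5), IR approach
exponent θ = β′(g*) = 2b₀g*² = 2.2·10⁻³, γ₀/(2b₀) = 12; N_f = 15: g*² = 16π²/88, α* = π/22 = 0.143;
N_f ≤ 8: b₁ > 0, no two-loop
zero; asymptotic freedom b₀ > 0 ⟺ N_f ≤ 16 (BanksZaks1982, Caswell1974). Higher loops: α*(N_f = 16)
≈ 0.04 at 3 and 4 loops MS-bar
(RyttovShrock2011). Transfer scale for N_f = 3: g(μ₀)² = 1.44 g*² = 0.75, α(μ₀) ≈ 0.06, i.e. μ₀ ~
10⁵ Λ — everything below is
InfraredCompletionP's. Items: 5 at open and after rev 1 (3 cruxes, 1 support, 1 assembly; rev 1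
replaced 9563/9564/9566 one-for-one); 6 after rev 2 (cruxes BZ 2, W 3, InfraredCompletionP 4,
PinnedFiniteVolumeLimit 5; support 9; assembly 1 = P → I → QCD).

DEFINITION REQUESTS. Filed right after open, both `--topic
Literature/MathematicalPhysics/QuantumLattice`, `--for` BanksZaksContinuum (the same two
notions HeavyThresholdYMBridge requested for its informal FermionicUVFlow — to be merged by the
operator if already queued):
(D1) BlockFermionRG — gauge-covariant block averaging of Wilson–Dirac Grassmann fields coupled to
the tree's block-averaged gauge
field (BalabanOcarrollSchor1989 (1.5)–(1.12); extends
`Literature.MathematicalPhysics.QuantumLattice.BalabanRG`'s `BlockRGScheme`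
by the fermionic Gaussian step and its effective density); (D2) QuasilocalGaugeActivityNorm — the
Banach space of gauge-invariant
quasi-local polymer activities with analyticity-strip / exponential-decay norm in which "the RG map
has a non-Gaussian fixed
point" and "the perturbation W_k has norm ≤ η" are statements (Balaban1988Convergent §2;
BauerschmidtBrydgesSlade2019RG Part II).
Cite facts wanted: none (Banks–Zaks is arithmetic over the tree's coefficients; the bib keys
BanksZaks1982, Caswell1974,
DamgaardEtAl1997, Hasenfratz2009, RyttovShrock2011, IwasakiEtAl2004 were added this session).

Novelty: Searches (2026-08-15): `lit search --hybrid "Banks-Zaks infrared fixed point rigorous construction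
renormalization group"` (12
rows, textbooks only: MontvayMunster1994 pp. 84/219, Rivasseau1991 pp. 239/255, Zinn-Justin — RG
generalities, nothing
constructive); `lit galaxy search "Banks-Zaks" --star all` (17 rows: SCGT-workshop proceedings,
conformal-window phenomenology,
arXiv:1908.04605 "Safety versus triviality on the lattice", arXiv:hep-ph/0104098 Grunberg "Conformal
window and Landau
singularities", unparticle cosmology — no rigorous work); `lit search --source crossref "On lattice
QCD with many flavors"`
(6 rows: IwasakiEtAl2004-type phase-structure numerics, N_f = 8, 12 staggered studies); `lit cite`
checks of BanksZaks1982,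
Caswell1974, DamgaardEtAl1997, Hasenfratz2009, RyttovShrock2011 (all resolved, added to
references.bib); the eight QCD route
files opened today (none mentions N_f = 16, a bounded-coupling flow or an infrared fixed point;
FemtoStepScaling's
"perturbative everywhere" corner is a SMALL BOX, HeavyThresholdYMBridge's is HEAVY QUARKS); the
card's own audit trail
(refuter-novelty-audit-QuantumFields-QCD-2-0: Hasenfratz2009 uses N_f = 16 as an MCRG validation
case, DamgaardEtAl1997 maps its
lattice phase structure — numerics only).
Nearest prior art found: BanksZaks1982 / Caswell1974 (the perturbative fixed point);
GiulianiMastropietroRychkov2021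
(arXiv:2008.04361: rigorous non-Gaussian FERMIONIC fixed point by convergent RG, no gauge field);
GawedzkiKupiai  [refs: 1908.04605, hep-ph/0104098, 2008.04361, MontvayMunster1994, Rivasseau1991, IwasakiEtAl2004, BanksZaks1982, Caswell1974, DamgaardEtAl1997, Hasenfratz2009, RyttovShrock2011, GiulianiMastropietroRychkov2021, GawedzkiKupiainenMasslessLattice1985, BrydgesMitterScoppola2003, BalabanOcarrollSchor1989, MagnenRivasseauSeneor1993]

Barriers (technique_class: multiscale-rg, bounded-coupling-fixed-point): - technique_class: multiscale-rg, bounded-coupling-fixed-point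
- Literature.Barriers.QuantumFields.UVStabilityNonUniqueness: it bites W honestly and is evaded in
the only admissible way — W asks convergence along an EXISTENTIAL scheme (subsequences allowed: weak
existence), which the statement `QCDOf` itself permits (human ruling Y2) because the axioms and the
gap are demanded separately (JW fn. 2 "unless one also uses other techniques to establish properties
of the limit") — that is InfraredCompletion; for BZ the bet is genuine convergence: with g_j ≤ 1.2
g* at every scale the per-scale expansions are convergent, the printed evasion (a) ("in the
superrenormalizable case Bałaban's own expansions are convergent").
- Literature.Barriers.QuantumFields.PerturbativeInvisibility: not engaged — BZ has no mass to see
(gapless by statement), W is an existence statement without a gap, and the gap lives entirely in the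
imported InfraredCompletion.
- Literature.Barriers.QuantumFields.LinearDivergenceRenormalon: evaded by construction — nothing is
Borel-summed; m_crit(k) is tuned scale-wise inside the flow (stable manifold of the one relevant
direction) and the O(a_kΛ) ambiguity of the additive mass — invisible at the cutoff to all orders —
is fixed since rev 2 by the INFRARED pin `IsChiralAtZero` (a lattice-spectral clause), not by any
perturbative subtraction; this is precisely why the pin must sit in the existence item P and cannot
be an ultraviolet certificate; at N_f = 16 massless th

History (route lifecycle, newest last):
- 2026-08-15T21:25:09Z · rev 3: restated WindowFiniteVolumeLimit (stmt-QuantumFields-9563), InfraredCompletion (stmt-QuantumFields-9564), Assembly (stmt-QuantumFields-9566) — repair rev 1 (route-repair rrefute-…-d0e812a6): items 9563 WindowFiniteVolumeLimit + 9564 InfraredCompletion refuted-misstated (refuter rattack-9563/ -9564 + rre (planner-rrefute-QuantumFields-BanksZaksTestbed-d0e812a6-0)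
- 2026-08-16T23:24:48Z · rev 4: restated InfraredCompletionR (stmt-QuantumFields-13788), Assembly (stmt-QuantumFields-13789) — route-repair rev 2 (statement-revised p117723: `QCDOf` gained `reg.IsChiralAtZero`): the new conjunct is SUPPLIED AS A HYPOTHESIS — the pin `reg.IsChiralAtZero` (planner-rrepair-QuantumFields-BanksZaksTestbed-66a8f2be-0)
- 2026-08-22T18:36:09Z · DORMANT — reconciler: no traction for 5.6 d (last activity item-evidence-added at 2026-08-17T04:23:58Z); parked, not closed — `ledger route dormant route-QuantumFields-Ba (operator:999:710225)
- 2026-08-28T21:12:02Z · REACTIVATED — reconciler: reactivated — activity statement-closed at 2026-08-28T18:43:40Z after parking at 2026-08-22T18:36:09Z (operator:999:2023326)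
- 2026-09-03T12:30:34Z · DORMANT — reconciler: no traction for 5 d (last activity statement-checked at 2026-08-29T11:38:43Z); parked, not closed — `ledger route dormant route-QuantumFields-BanksZ (operator:999:2343606)

sub-problem: QCD · status: dormant · opened planner-plancard-QuantumFields-QCD-banks-zaks-232b7964-0 2026-08-15T14:01:19Z · rev 5 · ledger route-QuantumFields-BanksZaksTestbed
GENERATED by the gate from the ledger (D-0016/17). Provers cite these decls: `theorem foo : Summit.QuantumFields.QCD.Theses.BanksZaksTestbed.<Decl> := …` in Summits/QuantumFields/QCD/Theorems/<Name>.lean.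
-/

namespace Summit.QuantumFields.QCD.Theses.BanksZaksTestbed

open scoped BigOperators Topology Manifold Classical MeasureTheory ProbabilityTheory Matrix InnerProductSpace ComplexConjugate ContinuousMap
open Filter Set Function TopologicalSpace MeasureTheory

attribute [summit_statement] _root_.QCD

/-- item stmt-QuantumFields-9562 · crux · rank 2 · open · by planner
why it might fail: No rigorous non-Gaussian IR fixed point with a dynamical gauge field exists in any d; g*² = 0.52 (β_W ≈ 11.5) must sit in Bałaban's NON-explicit small-field radius at every scale; θ = 2b₀g*² ≈ 2·10⁻³: marginal at both ends over infinitely many scales; gapless, so a_kL_k → ∞ has no clustering.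
sources: BanksZaks1982, Caswell1974, GiulianiMastropietroRychkov2021, GawedzkiKupiainenMasslessLattice1985, BauerschmidtBrydgesSlade2019RG, Balaban1989LargeFieldII
[crux] there is a sequential lattice-QCD scheme with SIXTEEN flavour-degenerate Wilson quarks (all
bare masses equal at every step; a_k → 0, a_k L_k → ∞, β_k with N_f = 16 two-loop asymptotic
scaling) and OS data T for the species of `QCDField 16` with `IsQCDAlong sch T`, `T.IsNontrivial
glue`, `T.IsNonGaussian glue`, every flavour-changing `pseudoRe f g` non-trivial, and NO mass gap:
`¬ T.HasMassGap Δ` for every Δ > 0 (card K1 ∧ K2 ⇒ `BanksZaksOf 16`; gaplessness is the typed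
certificate that the limit is the massless infrared-conformal theory, flavour degeneracy excludes a
partially-massive witness whose light sector breaks chiral symmetry). The testbed rung: deliberately
outside the Assembly; its layer-2 children (bounded-coupling block RG with g_j ≤ 1.2 g* at all
scales; convergence to the non-Gaussian fixed point) are where the fermionic lemmas of
WindowFiniteVolumeLimit are first proved. [difficulty: open-problem] -/
@[route_item "route-QuantumFields-BanksZaksTestbed"]
def BanksZaksContinuum : Prop :=
  ∃ sch : Literature.MathematicalPhysics.QuantumFieldTheory.QCDScheme 16, (∀ (f g : Fin 16) (k : ℕ), sch.mq f k = sch.mq g k) ∧ ∃ T : Literature.MathematicalPhysics.QuantumFieldTheory.OSData (Literature.MathematicalPhysics.QuantumFieldTheory.QCDField 16) 4, Literature.MathematicalPhysics.QuantumFieldTheory.IsQCDAlong sch T ∧ T.IsNontrivial Literature.MathematicalPhysics.QuantumFieldTheory.QCDField.glue ∧ T.IsNonGaussian Literature.MathematicalPhysics.QuantumFieldTheory.QCDField.glue ∧ (∀ f g : Fin 16, f ≠ g → T.IsNontrivial (Literature.MathematicalPhysics.QuantumFieldTheory.QCDField.pseudoRe f g)) ∧ ∀ Δ : ℝ, 0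 < Δ → ¬ T.HasMassGap Δ

/-- item stmt-QuantumFields-13787 · crux · rank 3 · open · by planner
why it might fail: Block-fermion RG with a DYNAMICAL non-abelian gauge field in d = 4 was never set up (BOS: external field; Dimock: abelian d = 3); ONE reg and ℓ-independent z, shift for all ℓ ≥ ℓ₀, m; N2 needs m_crit within O(a_k) of critical; signed weight (odd N_f, split masses); κ₃ ≠ 0 at separated points.
sources: Balaban1987RG1, Balaban1989LargeFieldII, BalabanOcarrollSchor1989, MagnenRivasseauSeneor1993, Dimock2022QED3, MontvayMunster1994
[crux] (rev 1 of WindowFiniteVolumeLimit stmt-QuantumFields-9563, planner route-repair 2026-08-15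
after refuter crux-attacks rattack-9563/ -9564 and route-review rreview-0815T14-0-g2, all
`refuted-misstated`: as typed in rev 0 the convergence clause and N1–N3 ranged over ALL real
Schwartz tuples, coincident supports included, which cutoff power counting (coincident smeared glue
2-point = z²a⁴‖f‖²·12/β², so convergence forces |z| = O(βa⁻²) and then every third cumulant is O(a²)
→ 0, ¬N3) makes unsatisfiable by honest data, while unrestricted N1/N2 were passed by contact terms
/ decoupled quarks. REPAIR, local: (CONV) is asked only for tuples f : Fin n → 𝓢(ℝ⁴, ℝ) with every
`tsupport (f i) ⊆ Metric.ball 0 (ℓ/4)` AND pairwise `Disjoint (tsupport (f i)) (tsupport (f j))` —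
the in-ball guard (refuter rattack-9563's C′) is needed on top of FemtoStepScaling's disjointness
guard because the smearing reads x ∈ box 4 ⌊ℓ/2a_k⌋ on the torus of side 2⌊ℓ/2a_k⌋+1, where the
faces x_μ = ∓ℓ/2 are ONE lattice spacing apart: supports disjoint in ℝ⁴ but reaching opposite faces
are torus-adjacent and the honest smeared 2-point function diverges like a_k^(4−d_A−d_B) (seam
contact); inside the ball torus -/
@[route_item "route-QuantumFields-BanksZaksTestbed"]
def WindowFiniteVolumeLimitR : Prop :=
  ∀ Nf : ℕ, 2 ≤ Nf → Nf ≤ 16 → ∃ reg : Literature.MathematicalPhysics.QuantumFieldTheory.QCDRegularisation Nf, (reg.HasMassScaling ∧ (∃ Λ > 0, Tendsto (fun k => reg.β k - Literature.MathematicalPhysics.QuantumFieldTheory.afBeta Nf Λ (reg.a k)) atTop (nhds 0)) ∧ (∀ᶠ k in atTop, (-1 : ℝ) < reg.mcrit k)) ∧ (∀ m : Fin Nf → ℝ, (∀ fl, 0 < m fl) → ∃ z shift : Literature.MathematicalPhysics.QuantumFieldTheory.QCDField Nf → ℕ → ℝ, ∃ W : ((ℓ : ℝ) → (n : ℕ)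 → (Fin n → Literature.MathematicalPhysics.QuantumFieldTheory.QCDField Nf) → (Fin n → SchwartzMap (EuclideanSpace ℝ (Fin 4)) ℝ) → ℂ), ∃ ℓ₀ > 0, (∀ ℓ : ℝ, ℓ₀ ≤ ℓ → ∀ (n : ℕ) (σ : Fin n → Literature.MathematicalPhysics.QuantumFieldTheory.QCDField Nf) (f : Fin n → SchwartzMap (EuclideanSpace ℝ (Fin 4)) ℝ), (∀ i : Fin n, tsupport (f i) ⊆ Metric.ball 0 (ℓ / 4)) → (∀ i j : Fin n, i ≠ j → Disjoint (tsupport (f i)) (tsupport (f j))) → Tendsto (fun k => Literature.MathematicalPhysics.QuantumFieldTheory.qcdTorusExpect (reg.β k) (2 * ⌊ℓ / (2 * reg.a k)⌋₊ + 1) (fun fl => (reg.scheme m 0 0).mq fl k) (fun U => (List.ofFn fun i : Fin n => (∑ x ∈ Literature.Probability.LatticeModels.box 4 ⌊ℓ / (2 * reg.a k)⌋₊, ((z (σ i) k * reg.a k ^ 4 * (f i) (reg.a k • Literature.MathematicalPhysics.QuantumLattice.siteToE x) : ℝ) : ℂ) • (Literature.MathematicalPhysics.QuantumFieldTheory.insertion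 U (σ i) x - algebraMap ℂ _ (((shift (σ i) k) : ℝ) : ℂ)))).prod)) atTop (nhds (W ℓ n σ f))) ∧ (∀ fl gl : Fin Nf, fl ≠ gl → ∃ ℓ : ℝ, ℓ₀ ≤ ℓ ∧ ∃ f g : SchwartzMap (EuclideanSpace ℝ (Fin 4)) ℝ, tsupport f ⊆ Metric.ball 0 (ℓ / 4) ∧ tsupport g ⊆ Metric.ball 0 (ℓ / 4) ∧ tsupport f ⊆ {x | x 0 < 0} ∧ tsupport g ⊆ {x | 0 < x 0} ∧ W ℓ 2 (fun _ => Literature.MathematicalPhysics.QuantumFieldTheory.QCDField.pseudoRe fl gl) ![f, g] ≠ W ℓ 1 (fun _ => Literature.MathematicalPhysics.QuantumFieldTheory.QCDField.pseudoRe fl gl) ![f] * W ℓ 1 (fun _ => Literature.MathematicalPhysics.QuantumFieldTheory.QCDField.pseudoRe fl gl) ![g]) ∧ ∀ s₀ : Literature.MathematicalPhysics.QuantumFieldTheory.QCDField Nf, s₀ = Literature.MathematicalPhysics.QuantumFieldTheory.QCDField.glue → (∃ ℓ : ℝ, ℓ₀ ≤ ℓ ∧ ∃ f g : SchwartzMap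 (EuclideanSpace ℝ (Fin 4)) ℝ, tsupport f ⊆ Metric.ball 0 (ℓ / 4) ∧ tsupport g ⊆ Metric.ball 0 (ℓ / 4) ∧ tsupport f ⊆ {x | x 0 < 0} ∧ tsupport g ⊆ {x | 0 < x 0} ∧ W ℓ 2 (fun _ => s₀) ![f, g] ≠ W ℓ 1 (fun _ => s₀) ![f] * W ℓ 1 (fun _ => s₀) ![g]) ∧ (∃ ℓ : ℝ, ℓ₀ ≤ ℓ ∧ ∃ f g h : SchwartzMap (EuclideanSpace ℝ (Fin 4)) ℝ, tsupport f ⊆ Metric.ball 0 (ℓ / 4) ∧ tsupport g ⊆ Metric.ball 0 (ℓ / 4) ∧ tsupport h ⊆ Metric.ball 0 (ℓ / 4) ∧ Disjoint (tsupport f) (tsupport g) ∧ Disjoint (tsupport f) (tsupport h) ∧ Disjoint (tsupport g) (tsupport h) ∧ W ℓ 3 (fun _ => s₀) ![f, g, h] - W ℓ 1 (fun _ => s₀) ![f] * W ℓ 2 (fun _ => s₀) ![g, h] - W ℓ 1 (fun _ => s₀) ![g] * W ℓ 2 (fun _ => s₀) ![f, h] - W ℓ 1 (fun _ => s₀) ![h]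 * W ℓ 2 (fun _ => s₀) ![f, g] + 2 * (W ℓ 1 (fun _ => s₀) ![f] * W ℓ 1 (fun _ => s₀) ![g] * W ℓ 1 (fun _ => s₀) ![h]) ≠ 0))

/-- item stmt-QuantumFields-17633 · crux · rank 4 · open · by planner
why it might fail: Carries the whole YM-hard infrared for massive N_f = 2,3 (thermodynamic limit from in-ball torus data, OS axioms, ONE volume-uniform gap for ALL lattice observables) AND now the chiral limit: locating m*, a gap at EVERY positive true mass however small, and m_π → 0⁺ uniformly in volume.
sources: JaffeWitten2000, JaffeWittenClay2006, OsterwalderSeiler1978, Seiler1982, Luscher1977, MontvayMunster1994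
[crux] (rev 2 of InfraredCompletionR stmt-QuantumFields-13788 — itself rev 1 of stmt-9564 —
route-repair 2026-08-16 after the statement re-type p117723: rev 1's conclusion `QCD` silently
acquired the chiral clause while its antecedent, W|≤3 with a FREE reference, could be met by
heavy-quark data only; restated PINNED and universally over the regularisation, concluding the
conjunct-level constant `QCDOf N_f`.) THE INFRARED HALF, imported: for N_f ∈ {2,3} and EVERY
mass-independent regularisation `reg` with leading-log mass scaling, N_f-flavour two-loop asymptotic
scaling, m_crit(k) > −1 eventually and `reg.IsChiralAtZero`, IF the guarded non-degenerate
finite-volume continuum limits of PinnedFiniteVolumeLimit / WindowFiniteVolumeLimitR hold along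
`reg` for every positive mass tuple (in-ball pairwise-disjoint CONV on every torus of physical side
ℓ ≥ ℓ₀; in-ball separated N1–N3), THEN `QCDOf N_f`. Intended proof, all infrared: (1) locate the
chiral point m* of reg — the infimum of the flavour-degenerate parameters above which the lattice
gap is locally bounded below; `IsChiralAtZero` forces m* ≥ 0 (were the reference above the chiral
line, every positive parameter would carry a unifor -/
@[route_item "route-QuantumFields-BanksZaksTestbed"]
def InfraredCompletionP : Prop :=
  ∀ Nf : ℕ, 2 ≤ Nf → Nf ≤ 3 → ∀ reg : Literature.MathematicalPhysics.QuantumFieldTheory.QCDRegularisation Nf, (reg.HasMassScaling ∧ (∃ Λ > 0, Tendsto (fun k => reg.β k - Literature.MathematicalPhysics.QuantumFieldTheory.afBeta Nf Λ (reg.a k)) atTop (nhds 0)) ∧ (∀ᶠ k in atTop, (-1 : ℝ) < reg.mcrit k) ∧ reg.IsChiralAtZero) → (∀ m : Fin Nf → ℝ, (∀ fl, 0 < m fl) → ∃ z shift : Literature.MathematicalPhysics.QuantumFieldTheory.QCDField Nf → ℕ → ℝ, ∃ W : ((ℓ : ℝ) → (n : ℕ) → (Fin n → Literature.MathematicalPhysics.QuantumFieldTheory.QCDField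 Nf) → (Fin n → SchwartzMap (EuclideanSpace ℝ (Fin 4)) ℝ) → ℂ), ∃ ℓ₀ > 0, (∀ ℓ : ℝ, ℓ₀ ≤ ℓ → ∀ (n : ℕ) (σ : Fin n → Literature.MathematicalPhysics.QuantumFieldTheory.QCDField Nf) (f : Fin n → SchwartzMap (EuclideanSpace ℝ (Fin 4)) ℝ), (∀ i : Fin n, tsupport (f i) ⊆ Metric.ball 0 (ℓ / 4)) → (∀ i j : Fin n, i ≠ j → Disjoint (tsupport (f i)) (tsupport (f j))) → Tendsto (fun k => Literature.MathematicalPhysics.QuantumFieldTheory.qcdTorusExpect (reg.β k) (2 * ⌊ℓ / (2 * reg.a k)⌋₊ + 1) (fun fl => (reg.scheme m 0 0).mq fl k) (fun U => (List.ofFn fun i : Fin n => (∑ x ∈ Literature.Probability.LatticeModels.box 4 ⌊ℓ / (2 * reg.a k)⌋₊, ((z (σ i) k * reg.a k ^ 4 * (f i) (reg.a k • Literature.MathematicalPhysics.QuantumLattice.siteToE x) : ℝ) : ℂ) • (Literature.MathematicalPhysics.QuantumFieldTheory.insertion U (σ i) x - algebraMap ℂ _ (((shift (σ i) k) : ℝ)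 : ℂ)))).prod)) atTop (nhds (W ℓ n σ f))) ∧ (∀ fl gl : Fin Nf, fl ≠ gl → ∃ ℓ : ℝ, ℓ₀ ≤ ℓ ∧ ∃ f g : SchwartzMap (EuclideanSpace ℝ (Fin 4)) ℝ, tsupport f ⊆ Metric.ball 0 (ℓ / 4) ∧ tsupport g ⊆ Metric.ball 0 (ℓ / 4) ∧ tsupport f ⊆ {x | x 0 < 0} ∧ tsupport g ⊆ {x | 0 < x 0} ∧ W ℓ 2 (fun _ => Literature.MathematicalPhysics.QuantumFieldTheory.QCDField.pseudoRe fl gl) ![f, g] ≠ W ℓ 1 (fun _ => Literature.MathematicalPhysics.QuantumFieldTheory.QCDField.pseudoRe fl gl) ![f] * W ℓ 1 (fun _ => Literature.MathematicalPhysics.QuantumFieldTheory.QCDField.pseudoRe fl gl) ![g]) ∧ ∀ s₀ : Literature.MathematicalPhysics.QuantumFieldTheory.QCDField Nf, s₀ = Literature.MathematicalPhysics.QuantumFieldTheory.QCDField.glue → (∃ ℓ : ℝ, ℓ₀ ≤ ℓ ∧ ∃ f g : SchwartzMap (EuclideanSpace ℝ (Fin 4)) ℝ, tsupport f ⊆ Metric.ball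 0 (ℓ / 4) ∧ tsupport g ⊆ Metric.ball 0 (ℓ / 4) ∧ tsupport f ⊆ {x | x 0 < 0} ∧ tsupport g ⊆ {x | 0 < x 0} ∧ W ℓ 2 (fun _ => s₀) ![f, g] ≠ W ℓ 1 (fun _ => s₀) ![f] * W ℓ 1 (fun _ => s₀) ![g]) ∧ (∃ ℓ : ℝ, ℓ₀ ≤ ℓ ∧ ∃ f g h : SchwartzMap (EuclideanSpace ℝ (Fin 4)) ℝ, tsupport f ⊆ Metric.ball 0 (ℓ / 4) ∧ tsupport g ⊆ Metric.ball 0 (ℓ / 4) ∧ tsupport h ⊆ Metric.ball 0 (ℓ / 4) ∧ Disjoint (tsupport f) (tsupport g) ∧ Disjoint (tsupport f) (tsupport h) ∧ Disjoint (tsupport g) (tsupport h) ∧ W ℓ 3 (fun _ => s₀) ![f, g, h] - W ℓ 1 (fun _ => s₀) ![f] * W ℓ 2 (fun _ => s₀) ![g, h] - W ℓ 1 (fun _ => s₀) ![g] * W ℓ 2 (fun _ => s₀) ![f, h] - W ℓ 1 (fun _ => s₀) ![h] * W ℓ 2 (fun _ => s₀) ![f, g] + 2 * (W ℓ 1 (fun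 _ => s₀) ![f] * W ℓ 1 (fun _ => s₀) ![g] * W ℓ 1 (fun _ => s₀) ![h]) ≠ 0)) → QCDOf Nf

/-- item stmt-QuantumFields-17635 · crux · rank 5 · open · by planner
why it might fail: All of W's risks at N_f = 2,3 plus the pin: a volume-uniform UPPER bound on the lightest flavoured state at small m > 0 along the SAME reg (m_π → 0, Goldstone) is proved for no 4d lattice gauge theory at weak coupling; and the RG-tuned reference must equal the chiral line to o(a_k/Z_m(k)).
sources: GellmannOakesRenner1968, GasserLeutwyler1984, SharpeSingleton1998, VafaWitten1984CMP, tHooft1980Naturalness, MontvayMunster1994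
[crux] (NEW in rev 2, route-repair 2026-08-16 after the statement re-type p117723 `QCDOf N_f := ∃
reg, HasMassScaling ∧ IsChiralAtZero ∧ ∀ m > 0, body`.) THE CHAIN'S EXISTENCE HALF, PINNED: for N_f
= 2 and N_f = 3 there is ONE mass-independent regularisation `reg` (a_k → 0, β_k with N_f-flavour
two-loop asymptotic scaling, flavour-blind m_crit(k) > −1 eventually, Z_m(k) ≍ c (log
a_k⁻²)^(γ₀/2β₀)) which is CHIRAL AT ZERO — `reg.IsChiralAtZero`: for every ε > 0 some POSITIVE mass
tuple has no volume-uniform lattice gap ε (the gap is not bounded below over the positive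
parameters: the reference m_crit(k) sits AT, not above, the chiral critical line, so positive
parameters reach arbitrarily light quarks) — such that for EVERY positive mass tuple m there are
species renormalisations z, shift, a limit functional W and ℓ₀ > 0 with WindowFiniteVolumeLimitR's
guarded body VERBATIM: convergence of the smeared renormalised n-point functions under
`qcdTorusExpect` on the torus of side 2⌊ℓ/2a_k⌋+1 for every ℓ ≥ ℓ₀ and every in-ball (`tsupport ⊆
Metric.ball 0 (ℓ/4)`), pairwise-disjoint tuple of real Schwartz functions; N1 (glue 2-point) and N2
(every flavour-changing pseudoRe 2-point) ≠ product o -/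
@[route_item "route-QuantumFields-BanksZaksTestbed"]
def PinnedFiniteVolumeLimit : Prop :=
  ∀ Nf : ℕ, 2 ≤ Nf → Nf ≤ 3 → ∃ reg : Literature.MathematicalPhysics.QuantumFieldTheory.QCDRegularisation Nf, (reg.HasMassScaling ∧ (∃ Λ > 0, Tendsto (fun k => reg.β k - Literature.MathematicalPhysics.QuantumFieldTheory.afBeta Nf Λ (reg.a k)) atTop (nhds 0)) ∧ (∀ᶠ k in atTop, (-1 : ℝ) < reg.mcrit k) ∧ reg.IsChiralAtZero) ∧ (∀ m : Fin Nf → ℝ, (∀ fl, 0 < m fl) → ∃ z shift : Literature.MathematicalPhysics.QuantumFieldTheory.QCDField Nf → ℕ → ℝ, ∃ W : ((ℓ : ℝ) → (n : ℕ) → (Fin n → Literature.MathematicalPhysics.QuantumFieldTheory.QCDField Nf) → (Fin n → SchwartzMap (EuclideanSpace ℝ (Fin 4)) ℝ) → ℂ), ∃ ℓ₀ > 0, (∀ ℓ : ℝ, ℓ₀ ≤ ℓ → ∀ (n : ℕ) (σ : Fin n → Literature.MathematicalPhysics.QuantumFieldTheory.QCDField Nf) (f : Fin n → SchwartzMap (EuclideanSpace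 ℝ (Fin 4)) ℝ), (∀ i : Fin n, tsupport (f i) ⊆ Metric.ball 0 (ℓ / 4)) → (∀ i j : Fin n, i ≠ j → Disjoint (tsupport (f i)) (tsupport (f j))) → Tendsto (fun k => Literature.MathematicalPhysics.QuantumFieldTheory.qcdTorusExpect (reg.β k) (2 * ⌊ℓ / (2 * reg.a k)⌋₊ + 1) (fun fl => (reg.scheme m 0 0).mq fl k) (fun U => (List.ofFn fun i : Fin n => (∑ x ∈ Literature.Probability.LatticeModels.box 4 ⌊ℓ / (2 * reg.a k)⌋₊, ((z (σ i) k * reg.a k ^ 4 * (f i) (reg.a k • Literature.MathematicalPhysics.QuantumLattice.siteToE x) : ℝ) : ℂ) • (Literature.MathematicalPhysics.QuantumFieldTheory.insertion U (σ i) x - algebraMap ℂ _ (((shift (σ i) k) : ℝ) : ℂ)))).prod)) atTop (nhds (W ℓ n σ f))) ∧ (∀ fl gl : Fin Nf, fl ≠ gl → ∃ ℓ : ℝ, ℓ₀ ≤ ℓ ∧ ∃ f g : SchwartzMap (EuclideanSpace ℝ (Fin 4)) ℝ, tsupport f ⊆ Metric.ball 0 (ℓ / 4) ∧ tsupport g ⊆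 Metric.ball 0 (ℓ / 4) ∧ tsupport f ⊆ {x | x 0 < 0} ∧ tsupport g ⊆ {x | 0 < x 0} ∧ W ℓ 2 (fun _ => Literature.MathematicalPhysics.QuantumFieldTheory.QCDField.pseudoRe fl gl) ![f, g] ≠ W ℓ 1 (fun _ => Literature.MathematicalPhysics.QuantumFieldTheory.QCDField.pseudoRe fl gl) ![f] * W ℓ 1 (fun _ => Literature.MathematicalPhysics.QuantumFieldTheory.QCDField.pseudoRe fl gl) ![g]) ∧ ∀ s₀ : Literature.MathematicalPhysics.QuantumFieldTheory.QCDField Nf, s₀ = Literature.MathematicalPhysics.QuantumFieldTheory.QCDField.glue → (∃ ℓ : ℝ, ℓ₀ ≤ ℓ ∧ ∃ f g : SchwartzMap (EuclideanSpace ℝ (Fin 4)) ℝ, tsupport f ⊆ Metric.ball 0 (ℓ / 4) ∧ tsupport g ⊆ Metric.ball 0 (ℓ / 4) ∧ tsupport f ⊆ {x | x 0 < 0} ∧ tsupport g ⊆ {x | 0 < x 0} ∧ W ℓ 2 (fun _ => s₀) ![f, g] ≠ W ℓ 1 (fun _ => s₀) ![f] * W ℓ 1 (fun _ => s₀) ![g])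 ∧ (∃ ℓ : ℝ, ℓ₀ ≤ ℓ ∧ ∃ f g h : SchwartzMap (EuclideanSpace ℝ (Fin 4)) ℝ, tsupport f ⊆ Metric.ball 0 (ℓ / 4) ∧ tsupport g ⊆ Metric.ball 0 (ℓ / 4) ∧ tsupport h ⊆ Metric.ball 0 (ℓ / 4) ∧ Disjoint (tsupport f) (tsupport g) ∧ Disjoint (tsupport f) (tsupport h) ∧ Disjoint (tsupport g) (tsupport h) ∧ W ℓ 3 (fun _ => s₀) ![f, g, h] - W ℓ 1 (fun _ => s₀) ![f] * W ℓ 2 (fun _ => s₀) ![g, h] - W ℓ 1 (fun _ => s₀) ![g] * W ℓ 2 (fun _ => s₀) ![f, h] - W ℓ 1 (fun _ => s₀) ![h] * W ℓ 2 (fun _ => s₀) ![f, g] + 2 * (W ℓ 1 (fun _ => s₀) ![f] * W ℓ 1 (fun _ => s₀) ![g] * W ℓ 1 (fun _ => s₀) ![h]) ≠ 0))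

/-- item stmt-QuantumFields-9565 · support · rank 9 · closed · proved by Summit.QuantumFields.QCD.Theorems.BanksZaksTestbed.banksZaksArithmetic_proof (prover) · by planner
sources: MontvayMunster1994, BanksZaks1982, Caswell1974
[support] the Banks–Zaks arithmetic of the tree's own coefficients (provable now,
`norm_num`/`field_simp` over `betaCoeff₀`, `betaCoeff₁`, `gammaCoeff₀`, `massExponent`): b₀(16) > 0,
b₁(16) < 0, −b₀(16)/b₁(16) = 16π²/302 (so g*² = 16π²/302, α* = g*²/4π = 2π/151), −b₀(15)/b₁(15) =
16π²/88 (second rung, α* = π/22), massExponent 16 = 12 (so `HasMassScaling` at N_f = 16 reads Z_m ≍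
c (log a_k⁻²)¹²), 0 < b₁(N_f) ↔ N_f ≤ 8 (no two-loop zero at or below eight flavours), 0 < b₀(N_f) ↔
N_f ≤ 16 (the asymptotic-freedom window). [difficulty: provable-now] -/
@[route_item "route-QuantumFields-BanksZaksTestbed"]
def BanksZaksArithmetic : Prop :=
  0 < Literature.MathematicalPhysics.QuantumFieldTheory.betaCoeff₀ 16 ∧ Literature.MathematicalPhysics.QuantumFieldTheory.betaCoeff₁ 16 < 0 ∧ -Literature.MathematicalPhysics.QuantumFieldTheory.betaCoeff₀ 16 / Literature.MathematicalPhysics.QuantumFieldTheory.betaCoeff₁ 16 = 16 * Real.pi ^ 2 / 302 ∧ -Literature.MathematicalPhysics.QuantumFieldTheory.betaCoeff₀ 15 / Literature.MathematicalPhysics.QuantumFieldTheory.betaCoeff₁ 15 = 16 * Real.pi ^ 2 / 88 ∧ Literature.MathematicalPhysics.QuantumFieldTheory.massExponent 16 = 12 ∧ (∀ Nf : ℕ, 0 < Literature.MathematicalPhysics.QuantumFieldTheory.betaCoeff₁ Nf ↔ Nf ≤ 8) ∧ (∀ Nf : ℕ, 0 < Literature.MathematicalPhysics.QuantumFieldTheory.betaCoeff₀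 Nf ↔ Nf ≤ 16)

-- `BanksZaksArithmetic` holds: proved by `Summit.QuantumFields.QCD.Theorems.BanksZaksTestbed.banksZaksArithmetic_proof` (its module imports this route file, so no `_holds` link can be stated here).

-- earlier Assembly (stmt-QuantumFields-13789, replaced 2026-08-16T23:24:48Z -> stmt-QuantumFields-17634): retired by None — WindowFiniteVolumeLimitR → InfraredCompletionR → QCD
-- earlier Assembly (stmt-QuantumFields-9566, replaced 2026-08-15T21:25:09Z -> stmt-QuantumFields-13789): retired by None — WindowFiniteVolumeLimit → InfraredCompletion → QCD
/-- item stmt-QuantumFields-17634 · assembly · rank 1 · closed · proved by Summit.QuantumFields.QCD.Theorems.banksZaksTestbed_assembly_proof (prover) · by planner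
sources: JaffeWitten2000, MontvayMunster1994
[assembly] (rev 2, route-repair 2026-08-16: restated over the pinned decls; rev 1 was
WindowFiniteVolumeLimitR → InfraredCompletionR → QCD, rev 0 WindowFiniteVolumeLimit →
InfraredCompletion → QCD) PinnedFiniteVolumeLimit → InfraredCompletionP → QCD; proved by the
deciding theorem `closes` of this file (destructure P's witness at N_f = 2, 3 and apply I there). -/
@[route_item "route-QuantumFields-BanksZaksTestbed"]
def Assembly : Prop :=
  PinnedFiniteVolumeLimit → InfraredCompletionP → QCD

-- `Assembly` holds: proved by `Summit.QuantumFields.QCD.Theorems.banksZaksTestbed_assembly_proof` (its module imports this route file, so no `_holds` link can be stated here).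

-- records of items no longer active in this route (dropped / restated):
-- earlier InfraredCompletionR (stmt-QuantumFields-13788, replaced 2026-08-16T23:24:48Z -> stmt-QuantumFields-17633): retired by None — (∀ Nf : ℕ, 2 ≤ Nf → Nf ≤ 3 → ∃ reg : Literature.MathematicalPhysics.QuantumFieldTheory.QCDRegularisation Nf, (reg.HasMassScaling ∧ (∃ Λ > 0, Tendsto (fun k => reg.β k - Literature.MathematicalPhysics.QuantumFieldTheory.afBeta Nf Λ (reg.a k)) atTop (nhds 0)) ∧ (∀ᶠ k i
-- earlier WindowFiniteVolumeLimit (stmt-QuantumFields-9563, replaced 2026-08-15T21:25:09Z -> stmt-QuantumFields-13787): retired by None — ∀ Nf : ℕ, 2 ≤ Nf → Nf ≤ 16 → ∃ reg : Literature.MathematicalPhysics.QuantumFieldTheory.QCDRegularisation Nf, (reg.HasMassScaling ∧ (∃ Λ > 0, Tendsto (fun k => reg.β k - Literature.MathematicalPhysics.QuantumFieldTheory.afBeta Nf Λ (reg.a k)) atTop (nhds 0)) ∧ (∀ᶠ 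
-- earlier InfraredCompletion (stmt-QuantumFields-9564, replaced 2026-08-15T21:25:09Z -> stmt-QuantumFields-13788): retired by None — (∀ Nf : ℕ, 2 ≤ Nf → Nf ≤ 3 → ∃ reg : Literature.MathematicalPhysics.QuantumFieldTheory.QCDRegularisation Nf, (reg.HasMassScaling ∧ (∃ Λ > 0, Tendsto (fun k => reg.β k - Literature.MathematicalPhysics.QuantumFieldTheory.afBeta Nf Λ (reg.a k)) atTop (nhds 0)) ∧ (∀ᶠ k in 

/-! D-0027 §2.1 — DECIDING THEOREM (planner-authored via `route open/edit --closes-file`; by planner-rrepair-QuantumFields-BanksZaksTestbed-66a8f2be-0 2026-08-16T23:24:48Z):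
its hypotheses are this route's items and its conclusion the sub-problem Statement (glue_lint), and it elaborates with this file. -/

/-- D-0027 §2.1 deciding theorem (rev 2, route-repair 2026-08-16 after the statement re-type p117723, `QCDOf N_f :=
∃ reg, HasMassScaling ∧ IsChiralAtZero ∧ ∀ m > 0, body`): pure logic. `QCD = QCDOf 2 ∧ QCDOf 3`; for `N_f = 2` and
`N_f = 3` take the witness `reg` of `PinnedFiniteVolumeLimit` — mass scaling, two-loop asymptotic scaling, physical
branch, CHIRAL AT ZERO, and the guarded non-degenerate finite-volume continuum limits at every positive mass tuple — and
hand it to the imported infrared half `InfraredCompletionP`, which is universally quantified over such regularisations and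
concludes `QCDOf N_f`. `WindowFiniteVolumeLimitR` (the window-uniform ultraviolet statement, whose restriction to
`N_f ≤ 3` is `PinnedFiniteVolumeLimit` minus the pin), `BanksZaksContinuum` (the laboratory) and `BanksZaksArithmetic`
(its numbers) are deliberately outside the chain. Rev 1 read `closes (hW : WindowFiniteVolumeLimitR)
(hIR : InfraredCompletionR) : QCD := hIR (restriction N_f ≤ 3 → N_f ≤ 16)`. -/
@[closes "route-QuantumFields-BanksZaksTestbed"] theorem closes (hP : PinnedFiniteVolumeLimit) (hI : InfraredCompletionP) : QCD := by
  refine ⟨?_, ?_⟩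
  · obtain ⟨reg, hreg, hbody⟩ := hP 2 (by norm_num) (by norm_num)
    exact hI 2 (by norm_num) (by norm_num) reg hreg hbody
  · obtain ⟨reg, hreg, hbody⟩ := hP 3 (by norm_num) (by norm_num)
    exact hI 3 (by norm_num) (by norm_num) reg hreg hbody

end Summit.QuantumFields.QCD.Theses.BanksZaksTestbed
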